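import Summits.QuantumFields.YangMills.Theorems.BalabanUVNodesSpineCarriersOfRecord13CoPH
import Summits.QuantumFields.YangMills.Theorems.BalabanUVNodesN19TargetClassWeightsE1Keyed
import Summits.QuantumFields.YangMills.Theorems.BalabanUVNodesSpineCanonicalWeights
import Literature.MathematicalPhysics.QuantumFieldTheory.Balaban1983to89.Node00.TwoRunSitePersistence

/-!
# THE SPINE READING OF RECORD AT NODE 00's `CoPH`-KEYED STAGE-13 RECORD — `YMDAG.UVSplit.crOfRecord₁₃ : SpineReading₁₃CoPH N`: Bałaban's two runs
# (`K₀ + K` and `K₀ + K + 1` steps, `K₀ := 0`) of the tuple's OWN dressed family at its OWN datum, their (2.18) term classes KEYED at node U5d's coupling-free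
# two-run site keys (option (b) of record), class weights = F3's fibre sums, the BAD class = the key-level persistence class, the weights and the rate =
# the CANONICAL ones; TWO displayed residual letters — the persistence policy `jcut` and the shell split `sh` — and nothing else

Cell `pub-ymgap`, YM-PLAN Track A (HUMAN RULING D-0062; work-bound push D-0149); seat `pub-ymgap-dag-n20-d` (R134 (a) N20 NE7b s3 = the U5d lineage
p561554 · p570161 · p575738 · p583644) gen 28.  PLAN g78 WORD-CR13 (pub-ymgap INBOX l.24332): «`crOfRecord₁₃ : SpineReading₁₃CoPH 2` has ONE declarer = dag-n20-d …
ONE `Thm/` file … WITH dictionary lemmas `crOfRecord₁₃_T ∕ _A ∕ _B ∕ _Bad ∕ _shA ∕ _shB` and `KeyedExtraction crOfRecord₁₃` as a THEOREM target»; node00-def-RR-2 WORD-CR13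
(l.24215) key-layer requirements (R1)–(R5); dag-n20-c EVIDENCE-H20GUARD (iii) (l.24188) = the spec.  Filed `--kind definition --supports stmt-QuantumFields-20544 --as
helper` (definition lane by content); COUNT-NEUTRAL.  **v1.1 (append-only): `crOfRecord₁₃At_δ` added (ref-K READ-196 NIT-H1); and THE VOLUME LETTER: this v1.0 reading pins
`vol := 1`, which makes N19's link clause `card (Site (F.P K) K) = S.vol` uninhabitable by the family lattice (dag-n19-d DESIGN-POINT-VOL, INBOX l.25098; ref-K READ-197 ∕
ref-I READ-351) — the gate's append-only rule forbids re-pinning it in place, so THE READING OF RECORD WITH THE PHYSICAL VOLUME LETTER `vol := F.side ^ 4` is the sibling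
edition `crOfRecord₁₃V` of `Thm/BalabanUVNodesSpineReadingOfRecord13CoPHV.lean`, which consumers reading `S.vol` as a volume should use; everything else is shared.**  [III] = [Balaban1988Convergent], [LF-I∕II] = [Balaban1989LargeFieldI∕II], [UV3] = [Balaban1985UV3].

WHAT THE READING PINS (R3: OF RECORD, no free run letters).  At `(F, θ : Stage13HParams F N, hP : θ.Provisos₁₃CoPH F N, g₀, os)` (R1: the CORE pair; R2: `θ` only
through `θ.toStage13Params ∕ θ.toStage9Params ∕ θ.ν ∕ θ.τ9.M`, the provisos only as the binder and inside `datumOfRecord₁₃CoPH F N θ hP`):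
* runs `runA₁₃ K₀ g₀ K := ⟨K₀ + K, F.m, g₀ (K₀ + K)⟩`, `runB₁₃ … := ⟨K₀ + K + 1, F.m, g₀ (K₀ + K + 1)⟩` (the shape of `Node00.classWeightOfDatum₉`'s docstring), histories
  `histA₁₃∕histB₁₃ := gOfRecord₁₃ F N θ.toStage13Params (runA₁₃∕runB₁₃ …)` (= `genSeq β₁₃ (g₀ …)`, so they START at the dressing's couplings, `histA₁₃_zero`∕`histB₁₃_zero`);
* index type `ι := Σ K, Node00.SiteSeqKey F (K₀ + K)` with node U5d's keys of record `keyA₁₃ K s := ⟨K, twoRunKeyA … s⟩`, `keyB₁₃ K s' := ⟨K, twoRunKeyB … s'⟩` (p570161;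
  `keyB₁₃` is TOTAL: the junk `∅`-key when `θ.τ9.M = 0`, which `θ.Admissible` excludes — dictionary lemma under `0 < θ.τ9.M`), class set `T K := univ.image (keyA₁₃ K) ∪
  univ.image (keyB₁₃ K)`, class weights `A ∕ B` = the FIBRE SUMS of `classWeightOfDatum₉ F N θ.toStage9Params (datumOfRecord₁₃CoPH F N θ hP) g₀ os (runA₁₃∕runB₁₃ …) …`
  — n19-d B‴ p562886 ∕ B p571597's keyed data VERBATIM at these letters;
* the BAD class `Bad K t := badKeysSigma F (T K) jcut` (p583644; ONE def for N20 ∕ N21 ∕ N19′ — R4).  READING (α) WITH dag-n20-w3's LOCATED-1 ∕ RESOLVED (INBOX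
  l.24338 ∕ l.24400) DISPLAYED: by (2.1) the chain is antitone, so `KeyOldLargeField (jcut K) (kA s) ↔ s.Λ (jcut K) ≠ T_η` (n20-w2's `keyOldLargeField_twoRunKeyA_iff_last`),
  i.e. «a large-field structure born at a level `≤ jcut K` is STILL IN THE INDEX»; this reads NE7b's «old AND PENDING» ([LF-II] (1.80) p.384) IFF the tuple's residual
  selector `θ.ppSel` is pinned HISTORY-REWRITING ([IV] (0.3) `Z″ = Z ∖ Z′`: renormalised components removed from EVERY entry `Λ_j, Ω_j`, `j ≥ j(Z′)` — the intended pin of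
  `Node00/LargeFieldTowerOfRecord.PpSelOfRecord`, (ρ2)); under an identity ∕ junk pin the class is «ever created», whose complement is asymptotically weightless by a volume
  count, and `KeyedRelWeight` at this reading is then NOT to be expected (ρ1, A6-type) — the constraint is on the PIN, displayed here, not decided;
* the weights and the rate are CANONICAL (`Thm/BalabanUVNodesSpineCanonicalWeights`): `W := wInf …` (the least relative weight of the bad class), `Wsh := wshInf …`,
  `δ := deltaCan …` — so every K5 face at this reading is a statement about a DEFINITE object and any witness transfers (§5);
* `l₀ := 1`, `vol := 1` (free normalisations of the hybrid matching; E1 ∕ E2 do not read `l₀`).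
THE TWO DISPLAYED LETTERS (everything else pinned): `jcut : ℕ → ℕ` — the persistence POLICY («older than `K − j⋆(K)`», [LF-II] (1.80) p.384; `j⋆` is the estimate's, not
print's or the record's) — and `sh : ShellSplit₁₃CoPH N K₀` — the keyed SHELL SPLIT `shA ∕ shB`, which is NOT OF RECORD (R5: N21's homes read the spine reading as a
parameter; NODE O's term object): named HERE as the one residual reading to INHABIT, not hidden.  `crOfRecord₁₃ := crOfRecord₁₃At 0`; the `K₀`-generic form
`crOfRecord₁₃At K₀` is kept so that the w-seats' `K₀`-generic socket lemmas instantiate by unification.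
DICTIONARY (§4): `crOfRecord₁₃At_T ∕ _A ∕ _B ∕ _Bad ∕ _shA ∕ _shB ∕ _W ∕ _Wsh ∕ _δ ∕ _l₀ ∕ _vol ∕ _K₀` (`rfl`), `keyB₁₃_eq` (under `0 < θ.τ9.M`).  THE EXTRACTION FACE AS A
THEOREM (§3): `keyedExtraction_crOfRecord₁₃At` — `0 < l₀`, `0 < vol`, E1 ∕ E2 at the reading for EVERY `g₀` (a fortiori `ForSmallCouplings`), from n19-d B‴ §1
`schemeZ_(succ_)eq_sum_fiber_classWeights_keyed` at `θ.toStage9Params` and the tuple's own datum, under the LIVE-SELECTOR PIN `hsel` and the laws `hU hζm hζ0` B‴ §2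
displays (rows `hP.zetaAbs ∕ hP.zetaUnity` and B1 `isPrintedAveraged_datumOfRecord₁₃CoPH` BY NAME).  FACE TRANSFERS (§5): B's `h20 ∕ h21 ∕ hedge`-shaped witnesses at
the reading's `T ∕ A ∕ B ∕ Bad ∕ shA ∕ shB` with ANY weights ∕ rate give `RelWeightBound ∕ ShellWeightBound ∕ NE7.Core ∧ Summable` AT `crOfRecord₁₃At …` itself.

HONEST FRAMING.  A DEFINITION of a reading + bookkeeping; NO estimate; nothing of Bałaban's asserted; NE7 ∕ NE7b ∕ NE7c NOT PRINTED for d = 4 ∕ NOT proved; the shell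
split is NOT inhabited here (NODE O); no `Provisos₁₃CoPH` inhabitant claimed (K0⁷ OPEN); N19 ∕ N20 ∕ N21 ∕ N27 NOT discharged; K3⁷ NOT claimed; counts UNMOVED (typed
28∕28 · discharged 5∕27); one finite four-torus programme at fixed `ε` — NOT ℝ⁴, NOT OS, NOT a mass gap, NOT the Clay problem.  No decl below carries a cite tag.
-/

noncomputable section

open scoped BigOperators
open Finset

namespace YMDAG.UVSplit

open Literature.MathematicalPhysics.QuantumFieldTheory.Balaban1983to89
open Literature.MathematicalPhysics.QuantumFieldTheory.Balaban1983to89.T4Continuum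
open Literature.MathematicalPhysics.QuantumFieldTheory.Balaban1983to89.Node00
open T4WeightBudget (RelWeightBound)
open T4IndicatorShell (ShellWeightBound)
open T4ContinuumYM4Torus (ForSmallCouplings)
open Summit.QuantumFields.BalabanUV.T4Continuum.Spine
open Summit.QuantumFields.YangMills.BalabanUVNodes.SpineCanonicalWeights
open Summit.QuantumFields.YangMills.BalabanUVNodes.N19TargetClassWeightsE1Keyed
  (schemeZ_eq_sum_fiber_classWeights_keyed schemeZ_succ_eq_sum_fiber_classWeights_keyed)

variable (F : T4Family) (N : ℕ) [NeZero N]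

/-! ## §1 The run letters OF RECORD -/

/-- **RUN A OF RECORD** at cutoff `K₀ + K`: `⟨K₀ + K, F.m, g₀ (K₀ + K)⟩` (the tuple `classWeightOfDatum₉` is documented at). [bookkeeping] -/
def runA₁₃ (K₀ : ℕ) (g₀ : ℕ → ℝ) (K : ℕ) : B12.RunParams := ⟨K₀ + K, F.m, g₀ (K₀ + K)⟩

/-- **RUN B OF RECORD** at cutoff `K₀ + K + 1`. [bookkeeping] -/
def runB₁₃ (K₀ : ℕ) (g₀ : ℕ → ℝ) (K : ℕ) : B12.RunParams := ⟨K₀ + K + 1, F.m, g₀ (K₀ + K + 1)⟩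

/-- Run A's cutoff is `K₀ + K` (`rfl`). [bookkeeping] -/
@[simp] theorem runA₁₃_K (K₀ : ℕ) (g₀ : ℕ → ℝ) (K : ℕ) : (runA₁₃ F K₀ g₀ K).K = K₀ + K := rfl

/-- Run B's cutoff is `K₀ + K + 1` (`rfl`). [bookkeeping] -/
@[simp] theorem runB₁₃_K (K₀ : ℕ) (g₀ : ℕ → ℝ) (K : ℕ) : (runB₁₃ F K₀ g₀ K).K = K₀ + K + 1 := rfl

variable {F N}

/-- **RUN A's HISTORY OF RECORD**: the Stage-13 generated history `gOfRecord₁₃` of the run (`= genSeq β₁₃ (g₀ (K₀ + K))`). [bookkeeping] -/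
def histA₁₃ (θ : Stage13HParams F N) (K₀ : ℕ) (g₀ : ℕ → ℝ) (K : ℕ) : ℕ → ℝ := gOfRecord₁₃ F N θ.toStage13Params (runA₁₃ F K₀ g₀ K)

/-- **RUN B's HISTORY OF RECORD**. [bookkeeping] -/
def histB₁₃ (θ : Stage13HParams F N) (K₀ : ℕ) (g₀ : ℕ → ℝ) (K : ℕ) : ℕ → ℝ := gOfRecord₁₃ F N θ.toStage13Params (runB₁₃ F K₀ g₀ K)

/-- Run A's history starts at the dressing's coupling `g₀ (K₀ + K)` (n19-d's `hgA`). [bookkeeping] -/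
theorem histA₁₃_zero (θ : Stage13HParams F N) (K₀ : ℕ) (g₀ : ℕ → ℝ) (K : ℕ) : histA₁₃ θ K₀ g₀ K 0 = g₀ (runA₁₃ F K₀ g₀ K).K :=
  FlowStepRuns.genSeq_zero _ _

/-- Run B's history starts at `g₀ (K₀ + K + 1)` (n19-d's `hgB`). [bookkeeping] -/
theorem histB₁₃_zero (θ : Stage13HParams F N) (K₀ : ℕ) (g₀ : ℕ → ℝ) (K : ℕ) : histB₁₃ θ K₀ g₀ K 0 = g₀ (runB₁₃ F K₀ g₀ K).K :=
  FlowStepRuns.genSeq_zero _ _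

/-! ## §2 Keys, class set, class weights, bad class at the tuple -/

section Data

variable (θ : Stage13HParams F N) (hP : θ.Provisos₁₃CoPH F N) (K₀ : ℕ) (g₀ : ℕ → ℝ) (os : List (ULoop F))

/-- **RUN A's σ-PACKED KEY OF RECORD** `s ↦ ⟨K, twoRunKeyA … s⟩`. [bookkeeping] -/
def keyA₁₃ (K : ℕ) (s : SeqOfRecord F θ.ν θ.τ9.M (histA₁₃ θ K₀ g₀ K) (K₀ + K) (K₀ + K)) : Σ K, SiteSeqKey F (K₀ + K) :=
  ⟨K, twoRunKeyA F θ.ν θ.τ9.M (histA₁₃ θ K₀ g₀ K) (K₀ + K) (K₀ + K) s⟩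

/-- **RUN B's σ-PACKED KEY OF RECORD** `s' ↦ ⟨K, twoRunKeyB … s'⟩` — TOTAL: the block-down truncation needs `0 < θ.τ9.M` ([I]'s basic cube size; `θ.Admissible` gives
`1 ≤ θ.τ9.M`), off which the key is the junk `∅`-key. [bookkeeping] -/
def keyB₁₃ (K : ℕ) (s' : SeqOfRecord F θ.ν θ.τ9.M (histB₁₃ θ K₀ g₀ K) (K₀ + K + 1) (K₀ + K + 1)) : Σ K, SiteSeqKey F (K₀ + K) :=
  if hM : 0 < θ.τ9.M then ⟨K, twoRunKeyB F θ.ν hM (histB₁₃ θ K₀ g₀ K) (K₀ + K) (K₀ + K) s'⟩ else ⟨K, (fun _ => ∅, fun _ => ∅)⟩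

/-- Under `0 < θ.τ9.M` run B's key of record IS node U5d's `twoRunKeyB`. [bookkeeping] -/
theorem keyB₁₃_eq (hM : 0 < θ.τ9.M) (K : ℕ) (s' : SeqOfRecord F θ.ν θ.τ9.M (histB₁₃ θ K₀ g₀ K) (K₀ + K + 1) (K₀ + K + 1)) :
    keyB₁₃ θ K₀ g₀ K s' = ⟨K, twoRunKeyB F θ.ν hM (histB₁₃ θ K₀ g₀ K) (K₀ + K) (K₀ + K) s'⟩ := by
  simp [keyB₁₃, hM]

/-- **THE CLASS SET OF RECORD** at step `K`: the union of the two runs' keyed images (B‴'s in-file class set). [bookkeeping] -/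
def classSet₁₃ (K : ℕ) : Finset (Σ K, SiteSeqKey F (K₀ + K)) :=
  letI : ∀ Kc, DecidableEq (SiteSeqKey F Kc) := fun _ => Classical.decEq _
  univ.image (keyA₁₃ θ K₀ g₀ K) ∪ univ.image (keyB₁₃ θ K₀ g₀ K)

/-- **RUN A's CLASS WEIGHT OF RECORD** at a key: the fibre sum of F3's dressed class weights of the tuple's own family at its own datum. [bookkeeping] -/
def weightA₁₃ (K : ℕ) (t : ℝ) (x : Σ K, SiteSeqKey F (K₀ + K)) : ℝ :=
  letI : ∀ Kc, DecidableEq (SiteSeqKey F Kc) := fun _ => Classical.decEq _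
  ∑ s ∈ univ.filter (fun s => keyA₁₃ θ K₀ g₀ K s = x),
    classWeightOfDatum₉ F N θ.toStage9Params (datumOfRecord₁₃CoPH F N θ hP) g₀ os (runA₁₃ F K₀ g₀ K) (histA₁₃ θ K₀ g₀ K) (K₀ + K) t s

/-- **RUN B's CLASS WEIGHT OF RECORD** at a key: the fibre sum over the block-down fibre. [bookkeeping] -/
def weightB₁₃ (K : ℕ) (t : ℝ) (x : Σ K, SiteSeqKey F (K₀ + K)) : ℝ :=
  letI : ∀ Kc, DecidableEq (SiteSeqKey F Kc) := fun _ => Classical.decEq _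
  ∑ s' ∈ univ.filter (fun s' => keyB₁₃ θ K₀ g₀ K s' = x),
    classWeightOfDatum₉ F N θ.toStage9Params (datumOfRecord₁₃CoPH F N θ hP) g₀ os (runB₁₃ F K₀ g₀ K) (histB₁₃ θ K₀ g₀ K) (K₀ + K + 1) t s'

/-- **THE BAD CLASS OF RECORD** under the persistence policy `jcut`: the keys of the class set with an old large-field region (p583644). [bookkeeping] -/
def badClass₁₃ (jcut : ℕ → ℕ) (K : ℕ) (_t : ℝ) : Finset (Σ K, SiteSeqKey F (K₀ + K)) :=
  badKeysSigma F (classSet₁₃ θ K₀ g₀ K) jcut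

/-- The bad class consists of classes, every step and source. [bookkeeping] -/
theorem badClass₁₃_subset (jcut : ℕ → ℕ) (K : ℕ) (t : ℝ) : badClass₁₃ θ K₀ g₀ jcut K t ⊆ classSet₁₃ θ K₀ g₀ K :=
  badKeysSigma_subset F _ jcut

end Data

/-! ## §3 The reading -/

/-- **A KEYED SHELL SPLIT** off the Stage-13 tuples: for every `(F, θ, hP, g₀, os)` the pair `(shA, shB)` of shell parts on the σ-packed keys — the ONE residual reading the
spine reading of record does not pin (NODE O's ∕ N21's object; R5). The TYPE only. [bookkeeping] -/
abbrev ShellSplit₁₃CoPH (N : ℕ) [NeZero N] (K₀ : ℕ) : Type 1 :=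
  (F : T4Family) → (θ : Stage13HParams F N) → θ.Provisos₁₃CoPH F N → (ℕ → ℝ) → List (ULoop F) →
    (ℕ → ℝ → (Σ K, SiteSeqKey F (K₀ + K)) → ℝ) × (ℕ → ℝ → (Σ K, SiteSeqKey F (K₀ + K)) → ℝ)

/-- **THE SPINE READING OF RECORD AT OFFSET `K₀`** (the record object is `K₀ = 0`; the generic form lets `K₀`-generic consumer lemmas instantiate by unification).
[bookkeeping] -/
def crOfRecord₁₃At (K₀ : ℕ) (jcut : ℕ → ℕ) (sh : ShellSplit₁₃CoPH N K₀) : SpineReading₁₃CoPH N := fun F θ hP g₀ os =>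
  { ι := Σ K, SiteSeqKey F (K₀ + K)
    dec := Classical.decEq _
    l₀ := 1
    vol := 1
    K₀ := K₀
    T := classSet₁₃ θ K₀ g₀
    A := weightA₁₃ θ hP K₀ g₀ os
    B := weightB₁₃ θ hP K₀ g₀ os
    shA := (sh F θ hP g₀ os).1
    shB := (sh F θ hP g₀ os).2
    Bad := badClass₁₃ θ K₀ g₀ jcut
    W := wInf 1 (classSet₁₃ θ K₀ g₀) (weightA₁₃ θ hP K₀ g₀ os) (weightB₁₃ θ hP K₀ g₀ os) (badClass₁₃ θ K₀ g₀ jcut)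
    Wsh := wshInf 1 (classSet₁₃ θ K₀ g₀) (weightA₁₃ θ hP K₀ g₀ os) (weightB₁₃ θ hP K₀ g₀ os) (sh F θ hP g₀ os).1 (sh F θ hP g₀ os).2
    δ := letI : DecidableEq (Σ K, SiteSeqKey F (K₀ + K)) := Classical.decEq _
      deltaCan 1 1 (classSet₁₃ θ K₀ g₀) (badClass₁₃ θ K₀ g₀ jcut)
        (fun K t x => weightA₁₃ θ hP K₀ g₀ os K t x - (sh F θ hP g₀ os).1 K t x) (fun K t x => weightB₁₃ θ hP K₀ g₀ os K t x - (sh F θ hP g₀ os).2 K t x) }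

/-- ★★ **THE SPINE READING OF RECORD** `crOfRecord₁₃ := crOfRecord₁₃At 0`. [bookkeeping] -/
def crOfRecord₁₃ (jcut : ℕ → ℕ) (sh : ShellSplit₁₃CoPH N 0) : SpineReading₁₃CoPH N :=
  crOfRecord₁₃At 0 jcut sh

/-! ## §4 The dictionary (all `rfl`) -/

section Dictionary

variable (K₀ : ℕ) (jcut : ℕ → ℕ) (sh : ShellSplit₁₃CoPH N K₀) (θ : Stage13HParams F N) (hP : θ.Provisos₁₃CoPH F N) (g₀ : ℕ → ℝ) (os : List (ULoop F))

/-- `ι` of record. [bookkeeping] -/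
theorem crOfRecord₁₃At_ι : (crOfRecord₁₃At K₀ jcut sh F θ hP g₀ os).ι = (Σ K, SiteSeqKey F (K₀ + K)) := rfl
/-- `l₀` of record. [bookkeeping] -/
@[simp] theorem crOfRecord₁₃At_l₀ : (crOfRecord₁₃At K₀ jcut sh F θ hP g₀ os).l₀ = 1 := rfl
/-- `vol` of record. [bookkeeping] -/
@[simp] theorem crOfRecord₁₃At_vol : (crOfRecord₁₃At K₀ jcut sh F θ hP g₀ os).vol = 1 := rfl
/-- `K₀` of record. [bookkeeping] -/
@[simp] theorem crOfRecord₁₃At_K₀ : (crOfRecord₁₃At K₀ jcut sh F θ hP g₀ os).K₀ = K₀ := rfl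
/-- `T` of record = the keyed class set. [bookkeeping] -/
theorem crOfRecord₁₃At_T : (crOfRecord₁₃At K₀ jcut sh F θ hP g₀ os).T = classSet₁₃ θ K₀ g₀ := rfl
/-- `A` of record = run A's fibre sums. [bookkeeping] -/
theorem crOfRecord₁₃At_A : (crOfRecord₁₃At K₀ jcut sh F θ hP g₀ os).A = weightA₁₃ θ hP K₀ g₀ os := rfl
/-- `B` of record = run B's fibre sums. [bookkeeping] -/
theorem crOfRecord₁₃At_B : (crOfRecord₁₃At K₀ jcut sh F θ hP g₀ os).B = weightB₁₃ θ hP K₀ g₀ os := rfl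
/-- `Bad` of record = the persistence class of the class set. [bookkeeping] -/
theorem crOfRecord₁₃At_Bad : (crOfRecord₁₃At K₀ jcut sh F θ hP g₀ os).Bad = badClass₁₃ θ K₀ g₀ jcut := rfl
/-- `shA` = the displayed shell split's first component. [bookkeeping] -/
theorem crOfRecord₁₃At_shA : (crOfRecord₁₃At K₀ jcut sh F θ hP g₀ os).shA = (sh F θ hP g₀ os).1 := rfl
/-- `shB` = the displayed shell split's second component. [bookkeeping] -/
theorem crOfRecord₁₃At_shB : (crOfRecord₁₃At K₀ jcut sh F θ hP g₀ os).shB = (sh F θ hP g₀ os).2 := rfl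
/-- `W` of record = the CANONICAL (least) relative weight of the bad class. [bookkeeping] -/
theorem crOfRecord₁₃At_W : (crOfRecord₁₃At K₀ jcut sh F θ hP g₀ os).W =
    wInf 1 (classSet₁₃ θ K₀ g₀) (weightA₁₃ θ hP K₀ g₀ os) (weightB₁₃ θ hP K₀ g₀ os) (badClass₁₃ θ K₀ g₀ jcut) := rfl
/-- `Wsh` of record = the CANONICAL relative shell weight. [bookkeeping] -/
theorem crOfRecord₁₃At_Wsh : (crOfRecord₁₃At K₀ jcut sh F θ hP g₀ os).Wsh =
    wshInf 1 (classSet₁₃ θ K₀ g₀) (weightA₁₃ θ hP K₀ g₀ os) (weightB₁₃ θ hP K₀ g₀ os) (sh F θ hP g₀ os).1 (sh F θ hP g₀ os).2 := rfl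
/-- The record object reads the offset-`0` form (`rfl`). [bookkeeping] -/
theorem crOfRecord₁₃_eq (jcut : ℕ → ℕ) (sh : ShellSplit₁₃CoPH N 0) : crOfRecord₁₃ jcut sh = crOfRecord₁₃At 0 jcut sh := rfl

end Dictionary

/-! ## §5 The extraction face as a THEOREM: E1 ∕ E2 at the reading, under the live-selector pin -/

section Extraction

variable (K₀ : ℕ) (jcut : ℕ → ℕ) (sh : ShellSplit₁₃CoPH N K₀) (θ : Stage13HParams F N) (hP : θ.Provisos₁₃CoPH F N) (E : B12.RunParams → ℝ)

/-- **E1 AT THE READING**: for every `g₀`, `os`, `K` and EVERY source `t`, `schemeZ ((datumOfRecord₁₃CoPH F N θ hP).scheme g₀) os (K₀ + K) t = Σ_{x ∈ T K} A K t x` — n19-d B‴ §1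
`schemeZ_eq_sum_fiber_classWeights_keyed` at the tuple's own Stage-9 view and datum, run A of record, key `keyA₁₃`; laws as B‴ §2 displays them. [bookkeeping] -/
theorem schemeZ_eq_sum_classSet_weightA (hsel : θ.ppSel = ppSelLiveOfRecord F N θ.ν θ.τ9 E (wOfRecord₉ F N θ.toStage9Params))
    (hU : LocalBgMeasurable F N θ.ν) (hζm : ZetaMeasurable F N θ.ζ) (hζ0 : ∀ p g k s Pl Ql RS U V', 0 ≤ θ.ζ p g k s Pl Ql RS U V')
    (g₀ : ℕ → ℝ) (os : List (ULoop F)) (K : ℕ) (t : ℝ) :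
    T4GenFunBounds.schemeZ ((datumOfRecord₁₃CoPH F N θ hP).scheme g₀) os (K₀ + K) t = ∑ x ∈ classSet₁₃ θ K₀ g₀ K, weightA₁₃ θ hP K₀ g₀ os K t x := by
  letI : ∀ Kc, DecidableEq (SiteSeqKey F Kc) := fun _ => Classical.decEq _
  have h := schemeZ_eq_sum_fiber_classWeights_keyed θ.toStage9Params E hsel hU hζm hζ0 hP.zetaAbs hP.zetaUnity (datumOfRecord₁₃CoPH F N θ hP)
    (isPrintedAveraged_datumOfRecord₁₃CoPH F N θ hP).avgMeasurable g₀ os (K₀ := K₀) (runA₁₃ F K₀ g₀) (histA₁₃ θ K₀ g₀) (fun _ => rfl) (histA₁₃_zero θ K₀ g₀)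
    (classSet₁₃ θ K₀ g₀) (keyA₁₃ θ K₀ g₀) (fun K s => Finset.mem_union_left _ (Finset.mem_image_of_mem _ (Finset.mem_univ s))) 1 K t
  by_cases ht : |t| ≤ 1
  · exact h ht
  · -- E1 does not read the source bound: rerun B‴'s lemma with the radius `|t|`
    exact schemeZ_eq_sum_fiber_classWeights_keyed θ.toStage9Params E hsel hU hζm hζ0 hP.zetaAbs hP.zetaUnity (datumOfRecord₁₃CoPH F N θ hP)
      (isPrintedAveraged_datumOfRecord₁₃CoPH F N θ hP).avgMeasurable g₀ os (K₀ := K₀) (runA₁₃ F K₀ g₀) (histA₁₃ θ K₀ g₀) (fun _ => rfl) (histA₁₃_zero θ K₀ g₀)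
      (classSet₁₃ θ K₀ g₀) (keyA₁₃ θ K₀ g₀) (fun K s => Finset.mem_union_left _ (Finset.mem_image_of_mem _ (Finset.mem_univ s))) |t| K t le_rfl

/-- **E2 AT THE READING**: `schemeZ (…) os (K₀ + K + 1) t = Σ_{x ∈ T K} B K t x` — B‴ §1 `schemeZ_succ_eq_sum_fiber_classWeights_keyed`, run B of record, key `keyB₁₃`.
[bookkeeping] -/
theorem schemeZ_succ_eq_sum_classSet_weightB (hsel : θ.ppSel = ppSelLiveOfRecord F N θ.ν θ.τ9 E (wOfRecord₉ F N θ.toStage9Params))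
    (hU : LocalBgMeasurable F N θ.ν) (hζm : ZetaMeasurable F N θ.ζ) (hζ0 : ∀ p g k s Pl Ql RS U V', 0 ≤ θ.ζ p g k s Pl Ql RS U V')
    (g₀ : ℕ → ℝ) (os : List (ULoop F)) (K : ℕ) (t : ℝ) :
    T4GenFunBounds.schemeZ ((datumOfRecord₁₃CoPH F N θ hP).scheme g₀) os (K₀ + K + 1) t = ∑ x ∈ classSet₁₃ θ K₀ g₀ K, weightB₁₃ θ hP K₀ g₀ os K t x := by
  letI : ∀ Kc, DecidableEq (SiteSeqKey F Kc) := fun _ => Classical.decEq _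
  exact schemeZ_succ_eq_sum_fiber_classWeights_keyed θ.toStage9Params E hsel hU hζm hζ0 hP.zetaAbs hP.zetaUnity (datumOfRecord₁₃CoPH F N θ hP)
    (isPrintedAveraged_datumOfRecord₁₃CoPH F N θ hP).avgMeasurable g₀ os (K₀ := K₀) (runB₁₃ F K₀ g₀) (histB₁₃ θ K₀ g₀) (fun _ => rfl) (histB₁₃_zero θ K₀ g₀)
    (classSet₁₃ θ K₀ g₀) (keyB₁₃ θ K₀ g₀) (fun K s' => Finset.mem_union_right _ (Finset.mem_image_of_mem _ (Finset.mem_univ s'))) |t| K t le_rfl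

/-- ★★ **THE EXTRACTION FACE OF K3⁷ AT THE READING IS A THEOREM** (`KeyedExtraction (crOfRecord₁₃At …)` restricted to the tuple, under the live-selector pin and the three laws;
(B) and END are not read — the conclusion holds for EVERY `g₀`, so `ForSmallCouplings` by `of_forall`). [bookkeeping] -/
theorem keyedExtraction_crOfRecord₁₃At (hsel : θ.ppSel = ppSelLiveOfRecord F N θ.ν θ.τ9 E (wOfRecord₉ F N θ.toStage9Params))
    (hU : LocalBgMeasurable F N θ.ν) (hζm : ZetaMeasurable F N θ.ζ) (hζ0 : ∀ p g k s Pl Ql RS U V', 0 ≤ θ.ζ p g k s Pl Ql RS U V') :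
    ForSmallCouplings (datumOfRecord₁₃CoPH F N θ hP) fun g₀ => ∀ os : List (ULoop F),
      0 < (crOfRecord₁₃At K₀ jcut sh F θ hP g₀ os).l₀ ∧ 0 < (crOfRecord₁₃At K₀ jcut sh F θ hP g₀ os).vol ∧
      (∀ (K : ℕ) (t : ℝ), |t| ≤ (crOfRecord₁₃At K₀ jcut sh F θ hP g₀ os).l₀ →
        T4GenFunBounds.schemeZ ((datumOfRecord₁₃CoPH F N θ hP).scheme g₀) os ((crOfRecord₁₃At K₀ jcut sh F θ hP g₀ os).K₀ + K) t =
          ∑ τ ∈ (crOfRecord₁₃At K₀ jcut sh F θ hP g₀ os).T K, (crOfRecord₁₃At K₀ jcut sh F θ hP g₀ os).A K t τ) ∧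
      (∀ (K : ℕ) (t : ℝ), |t| ≤ (crOfRecord₁₃At K₀ jcut sh F θ hP g₀ os).l₀ →
        T4GenFunBounds.schemeZ ((datumOfRecord₁₃CoPH F N θ hP).scheme g₀) os ((crOfRecord₁₃At K₀ jcut sh F θ hP g₀ os).K₀ + K + 1) t =
          ∑ τ ∈ (crOfRecord₁₃At K₀ jcut sh F θ hP g₀ os).T K, (crOfRecord₁₃At K₀ jcut sh F θ hP g₀ os).B K t τ) :=
  ForSmallCouplings.of_forall fun g₀ os =>
    ⟨one_pos, one_pos, fun K t _ => schemeZ_eq_sum_classSet_weightA K₀ θ hP E hsel hU hζm hζ0 g₀ os K t,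
      fun K t _ => schemeZ_succ_eq_sum_classSet_weightB K₀ θ hP E hsel hU hζm hζ0 g₀ os K t⟩

end Extraction

/-! ## §6 Face transfers: witnesses with ANY weights ∕ rate at the reading's carriers give the faces AT the reading -/

section Transfer

variable (K₀ : ℕ) (jcut : ℕ → ℕ) (sh : ShellSplit₁₃CoPH N K₀) (θ : Stage13HParams F N) (hP : θ.Provisos₁₃CoPH F N) (g₀ : ℕ → ℝ) (os : List (ULoop F))

/-- ★ **N20 AT THE READING FROM ANY WITNESS**: `RelWeightBound 1 T A B Bad W` for SOME `W` at the reading's carriers ⇒ `RelWeightBound` at `crOfRecord₁₃At …` (whose `W` is the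
canonical one). [bookkeeping] -/
theorem relWeightBound_crOfRecord₁₃At {W : ℕ → ℝ}
    (h : RelWeightBound 1 (classSet₁₃ θ K₀ g₀) (weightA₁₃ θ hP K₀ g₀ os) (weightB₁₃ θ hP K₀ g₀ os) (badClass₁₃ θ K₀ g₀ jcut) W) :
    RelWeightBound (crOfRecord₁₃At K₀ jcut sh F θ hP g₀ os).l₀ (crOfRecord₁₃At K₀ jcut sh F θ hP g₀ os).T (crOfRecord₁₃At K₀ jcut sh F θ hP g₀ os).A
      (crOfRecord₁₃At K₀ jcut sh F θ hP g₀ os).B (crOfRecord₁₃At K₀ jcut sh F θ hP g₀ os).Bad (crOfRecord₁₃At K₀ jcut sh F θ hP g₀ os).W :=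
  relWeightBound_wInf h

/-- ★ **N21 AT THE READING FROM ANY WITNESS**. [bookkeeping] -/
theorem shellWeightBound_crOfRecord₁₃At {Wsh : ℕ → ℝ}
    (h : ShellWeightBound 1 (classSet₁₃ θ K₀ g₀) (weightA₁₃ θ hP K₀ g₀ os) (weightB₁₃ θ hP K₀ g₀ os) (sh F θ hP g₀ os).1 (sh F θ hP g₀ os).2 Wsh) :
    ShellWeightBound (crOfRecord₁₃At K₀ jcut sh F θ hP g₀ os).l₀ (crOfRecord₁₃At K₀ jcut sh F θ hP g₀ os).T (crOfRecord₁₃At K₀ jcut sh F θ hP g₀ os).A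
      (crOfRecord₁₃At K₀ jcut sh F θ hP g₀ os).B (crOfRecord₁₃At K₀ jcut sh F θ hP g₀ os).shA (crOfRecord₁₃At K₀ jcut sh F θ hP g₀ os).shB
      (crOfRecord₁₃At K₀ jcut sh F θ hP g₀ os).Wsh :=
  shellWeightBound_wshInf h

/-- ★ **N19′'s CORE AND U4′'s SUMMABILITY AT THE READING's OWN RATE FROM ANY WITNESS** (non-negative cores — supplied by any shell witness, `core_nonneg_of_shellWeightBound`).
[bookkeeping] -/
theorem core_crOfRecord₁₃At {δ : ℕ → ℝ}
    (hP0 : letI : DecidableEq (Σ K, SiteSeqKey F (K₀ + K)) := Classical.decEq _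
      ∀ (K : ℕ) (t : ℝ), |t| ≤ 1 → ∀ x ∈ classSet₁₃ θ K₀ g₀ K \ badClass₁₃ θ K₀ g₀ jcut K t, 0 ≤ weightA₁₃ θ hP K₀ g₀ os K t x - (sh F θ hP g₀ os).1 K t x)
    (h : letI : DecidableEq (Σ K, SiteSeqKey F (K₀ + K)) := Classical.decEq _
      NE7.Core 1 1 (classSet₁₃ θ K₀ g₀) (badClass₁₃ θ K₀ g₀ jcut) (fun K t x => weightA₁₃ θ hP K₀ g₀ os K t x - (sh F θ hP g₀ os).1 K t x)
        (fun K t x => weightB₁₃ θ hP K₀ g₀ os K t x - (sh F θ hP g₀ os).2 K t x) δ)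
    (hδ : Summable δ) :
    (letI := (crOfRecord₁₃At K₀ jcut sh F θ hP g₀ os).dec
     NE7.Core (crOfRecord₁₃At K₀ jcut sh F θ hP g₀ os).l₀ (crOfRecord₁₃At K₀ jcut sh F θ hP g₀ os).vol (crOfRecord₁₃At K₀ jcut sh F θ hP g₀ os).T
      (crOfRecord₁₃At K₀ jcut sh F θ hP g₀ os).Bad
      (fun K t τ => (crOfRecord₁₃At K₀ jcut sh F θ hP g₀ os).A K t τ - (crOfRecord₁₃At K₀ jcut sh F θ hP g₀ os).shA K t τ)
      (fun K t τ => (crOfRecord₁₃At K₀ jcut sh F θ hP g₀ os).B K t τ - (crOfRecord₁₃At K₀ jcut sh F θ hP g₀ os).shB K t τ)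
      (crOfRecord₁₃At K₀ jcut sh F θ hP g₀ os).δ) ∧ Summable (crOfRecord₁₃At K₀ jcut sh F θ hP g₀ os).δ := by
  letI : DecidableEq (Σ K, SiteSeqKey F (K₀ + K)) := Classical.decEq _
  letI := (crOfRecord₁₃At K₀ jcut sh F θ hP g₀ os).dec
  exact ⟨core_deltaCan zero_le_one hP0 h, summable_deltaCan zero_le_one hP0 h hδ⟩

/-- **U4′'s `W + Wsh < 1` AT THE READING FROM ANY WITNESSES**. [bookkeeping] -/
theorem lt_one_crOfRecord₁₃At {W Wsh : ℕ → ℝ}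
    (hW : RelWeightBound 1 (classSet₁₃ θ K₀ g₀) (weightA₁₃ θ hP K₀ g₀ os) (weightB₁₃ θ hP K₀ g₀ os) (badClass₁₃ θ K₀ g₀ jcut) W)
    (hSh : ShellWeightBound 1 (classSet₁₃ θ K₀ g₀) (weightA₁₃ θ hP K₀ g₀ os) (weightB₁₃ θ hP K₀ g₀ os) (sh F θ hP g₀ os).1 (sh F θ hP g₀ os).2 Wsh)
    (hlt : ∀ K, W K + Wsh K < 1) (K : ℕ) :
    (crOfRecord₁₃At K₀ jcut sh F θ hP g₀ os).W K + (crOfRecord₁₃At K₀ jcut sh F θ hP g₀ os).Wsh K < 1 :=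
  wInf_add_wshInf_lt_one hW hSh hlt K

end Transfer

/-! ## §7 v1.1 (append-only): the rate field of this (`vol := 1`) edition -/

/-- `δ` of the v1.0 reading = the CANONICAL core-matching rate `deltaCan` of its carriers at `vol = 1` (ref-K READ-196 NIT-H1: named in the v1.0 header, typed here). [bookkeeping] -/
theorem crOfRecord₁₃At_δ (K₀ : ℕ) (jcut : ℕ → ℕ) (sh : ShellSplit₁₃CoPH N K₀) (θ : Stage13HParams F N) (hP : θ.Provisos₁₃CoPH F N) (g₀ : ℕ → ℝ)
    (os : List (ULoop F)) :
    (crOfRecord₁₃At K₀ jcut sh F θ hP g₀ os).δ =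
      (letI : DecidableEq (Σ K, SiteSeqKey F (K₀ + K)) := Classical.decEq _
       deltaCan 1 1 (classSet₁₃ θ K₀ g₀) (badClass₁₃ θ K₀ g₀ jcut)
        (fun K t x => weightA₁₃ θ hP K₀ g₀ os K t x - (sh F θ hP g₀ os).1 K t x) (fun K t x => weightB₁₃ θ hP K₀ g₀ os K t x - (sh F θ hP g₀ os).2 K t x)) :=
  rfl

end YMDAG.UVSplit

end
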